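import Summits.Ventures.Crystal3D.Theorems.StickyWulffConstantNoReconstructionGainHollowLoad
import Summits.Ventures.Crystal3D.Theorems.StickyWulffConstantNoReconstructionGainTopRowNine
import HarnessLib

/-!
# The sliding-window weighted kissing bound and the upper half of the `W = √(2/3)` certificate
# (crux `NoReconstructionGain`, stmt-Ventures-19144, line `replication-exactness`, inside `stub_noCriminal`)

HONEST FRAMING. Part of the venture `Summits/Ventures/Crystal3D` (cell `crystal3d-full`), helper `--supports` the
crux `NoReconstructionGain` (stmt-Ventures-19144, route `route-Ventures-StickyWulffConstant`), lead wulff-p1 g24.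
A RUNG of the pointwise ("weighted kissing") method for height-confined `(111)` films, not a resolution of the crux.

Write `c = √(2/3)`.  `…NoReconstructionGainHollowLoad` proved the hollow-ball load bound
`Σ_{u ∈ F, 0 ≤ u₂ ≤ c} (1 − u₂/c) ≤ 6` for every `60°`-code `F` by a weighted azimuth budget.  This file SLIDES
THE WINDOW: for every `d ∈ [0, c]`,

  `Σ_{u ∈ F, −d ≤ u₂ ≤ c − d} (1 − |u₂|/c) ≤ 6`                                  (`weightedWindowKissing_le_six`)

— tight at `d = 0` (hexagon + three tops) AND at `d = c` (Kertész's nine-point code seen from the top ball: hexagon +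
hollow triple at depth `c`, weight `6·1 + 3·0`).  The only new ingredient is the OPPOSITE-SIDE pair lemma
(`windowPair_cos_bound`, `window_azimuthGap_ge`): a code vector at height `z ≥ 0` and one at depth `y ≥ 0` with
`z + y ≤ c` differ in azimuth by `≥ (π/6)(1 − z/c) + (π/6)(1 − y/c)` (the constraint `z + y ≤ c` is exactly what a
window of height `c` guarantees, and is needed: a top vector at height `c` and a slightly sub-equatorial one can be
`20°` apart); again chords of `cos` plus a polynomial inequality with an explicit non-negative decomposition.

CONSEQUENCE (sequel `…NoReconstructionGainWindowRows`, `confinedRow_ramp_of_neg_half_le`): the rows `a ∈ [−c/2, 0]` of the windowed weighted-kissing bound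
`ConfinedCodeBoundPhys √(2/3) g` for the clipped linear ramp `g z = min 2 (max 0 (1 − z/c))` — i.e. the certificate
inequality `2·plug + Σ_partners g ≤ 12` at every film ball at height `h ∈ [(k+1)c, (k+1)c + c/2]` of a `(111)` film
over layer `k` confined below `(k+2)c`: the partners in the window `[a, a+c]` weigh `(1 − |u₂|/c) + 2|u₂|/c·[u₂<0]`,
the first part totals `≤ 6` by the sliding window, the sub-equatorial excess is `≤ (2/c)·6·|a|` (at most six
partners strictly below the ball's equator and above depth `1/2`, `card_band_le_six`), and the plugs (`≤ 3`, and
`≤ 2, 1, 0` as `|a|` grows, `card_mul_sq_le_of_sameHeight`) weigh `2` each; the budget closes exactly at `|a| = c/2`.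
Together with `hollowRow_ramp` (`a = 0`, subsumed) and `topRow_ramp_of_card_ne` (`a = −c`, partner counts `≠ 7, 8`)
these are ALL PLUG-CARRYING rows and both TIGHT rows of the `W = c` window.  WHAT IS LEFT for «no `(111)` criminal
below `(k+2)√(2/3)`» via `not_isCriminal_basal_of_confinedCodeBoundPhys`: the plug-free rows `a ∈ [−c, −c/2)`
(slack, certificate-shaped; at `a = −c` only the partner counts `7, 8`).  Rung F-C1 not moved.
-/

noncomputable section

namespace Summit.Ventures.Crystal3D.Theorems

open Finset Real
open scoped InnerProductSpace

/-! ## 1. The opposite-side pair lemma -/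

/-- The polynomial inequality behind the opposite-side pair lemma (`a + b ≤ 1`, `s = √3`):
`(3 + 4ab)² ≤ (3 − 2a²)(3 − 2b²)(1 + (s − 1)(a + b))²`.  With `p = a+b`, `q = ab`, `E = 6(s−1) + 4p + (8−4s)p²`,
`F = 24(s−1) + (48−24s)(1+p) + 8(s−1)q + (16−8s)q(1+p)` the difference is `(1−p)(3pE − qF) + q(12 − 4q)`
(mod `s² = 3`), and `qF ≤ (p²/4)F ≤ 3pE`; equality at `(0,0)`, `(0,1)`, `(1,0)`. -/
theorem windowPair_poly {a b s : ℝ} (ha : 0 ≤ a) (hb : 0 ≤ b) (hab : a + b ≤ 1) (hs : s ^ 2 = 3)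
    (hs1 : 17 / 10 ≤ s) (hs2 : s ≤ 2) :
    (3 + 4 * a * b) ^ 2 ≤ (3 - 2 * a ^ 2) * (3 - 2 * b ^ 2) * (1 + (s - 1) * (a + b)) ^ 2 := by
  set p := a + b with hp
  set q := a * b with hq
  set E := 6 * (s - 1) + 4 * p + (8 - 4 * s) * p ^ 2 with hE
  set F := 24 * (s - 1) + (48 - 24 * s) * (1 + p) + 8 * (s - 1) * q + (16 - 8 * s) * q * (1 + p) with hF
  have key : (3 - 2 * a ^ 2) * (3 - 2 * b ^ 2) * (1 + (s - 1) * (a + b)) ^ 2 - (3 + 4 * a * b) ^ 2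
      = (1 - p) * (3 * p * E - q * F) + q * (12 - 4 * q) := by
    rw [hE, hF, hp, hq]
    linear_combination ((3 - 2 * a ^ 2) * (3 - 2 * b ^ 2) * (a + b) ^ 2) * hs
  have hp0 : 0 ≤ p := by rw [hp]; linarith
  have hp1 : p ≤ 1 := hab
  have hq0 : 0 ≤ q := mul_nonneg ha hb
  have hq4 : 4 * q ≤ p ^ 2 := by rw [hp, hq]; nlinarith [sq_nonneg (a - b)]
  have hq1 : q ≤ 1 / 4 := by nlinarith
  have hE0 : 6 * (s - 1) ≤ E := by
    rw [hE]; nlinarith [mul_nonneg (by linarith : (0:ℝ) ≤ 8 - 4 * s) (sq_nonneg p)]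
  have hF0 : 0 ≤ F := by
    rw [hF]
    have h1 : 0 ≤ (48 - 24 * s) * (1 + p) := mul_nonneg (by linarith) (by linarith)
    have h2 : 0 ≤ 8 * (s - 1) * q := mul_nonneg (by linarith) hq0
    have h3 : 0 ≤ (16 - 8 * s) * q * (1 + p) := mul_nonneg (mul_nonneg (by linarith) hq0) (by linarith)
    linarith
  -- `F ≤ 24(s−1) + 2(48−24s) + 2(s−1) + (16−8s)/2 = 114 − ... ` crude upper bound, and `12E − pF ≥ 0`
  have hFle : F ≤ 24 * (s - 1) + (48 - 24 * s) * 2 + 8 * (s - 1) * (1 / 4) + (16 - 8 * s) * (1 / 4) * 2 := by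
    rw [hF]
    have h1 : (48 - 24 * s) * (1 + p) ≤ (48 - 24 * s) * 2 := mul_le_mul_of_nonneg_left (by linarith) (by linarith)
    have h2 : 8 * (s - 1) * q ≤ 8 * (s - 1) * (1 / 4) := mul_le_mul_of_nonneg_left hq1 (by linarith)
    have h3 : (16 - 8 * s) * q * (1 + p) ≤ (16 - 8 * s) * (1 / 4) * 2 := by
      apply mul_le_mul (mul_le_mul_of_nonneg_left hq1 (by linarith)) (by linarith) (by linarith)
      exact mul_nonneg (by linarith) (by norm_num)
    linarith
  have hkey2 : q * F ≤ 3 * p * E := by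
    have h1 : q * F ≤ p ^ 2 / 4 * F := mul_le_mul_of_nonneg_right (by linarith) hF0
    have h2 : p ^ 2 / 4 * F ≤ 3 * p * E := by
      -- `p/4 · (p F) ≤ p/4 · 12 E`
      have h3 : p * F ≤ 12 * E := by
        have : p * F ≤ 1 * F := mul_le_mul_of_nonneg_right hp1 hF0
        nlinarith [hE0, hFle]
      have : p ^ 2 / 4 * F = p / 4 * (p * F) := by ring
      rw [this]
      have : 3 * p * E = p / 4 * (12 * E) := by ring
      rw [this]
      exact mul_le_mul_of_nonneg_left h3 (by linarith)
    exact h1.trans h2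
  have t1 : 0 ≤ (1 - p) * (3 * p * E - q * F) := mul_nonneg (by linarith) (by linarith)
  have t2 : 0 ≤ q * (12 - 4 * q) := mul_nonneg hq0 (by linarith)
  linarith [key, t1, t2]

/-- **The opposite-side pair lemma in analytic form.**  For a height `ca` and a depth `cb` with `a, b ≥ 0`,
`a + b ≤ 1` (`c = √(2/3)`): `1/2 + (2/3)ab ≤ √(1 − (2/3)a²) · √(1 − (2/3)b²) · cos (π/3 − (π/6)(a + b))`, i.e.
two `60°`-separated unit vectors on opposite sides of the equator, at height `ca` and depth `cb`, differ in azimuth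
by at least `(π/6)(1−a) + (π/6)(1−b)`.  Equality at `(0,0)` and at `(0,1)`, `(1,0)`; false without `a + b ≤ 1`. -/
theorem windowPair_cos_bound {a b : ℝ} (ha : 0 ≤ a) (hb : 0 ≤ b) (hab : a + b ≤ 1) :
    1 / 2 + 2 / 3 * a * b ≤ Real.sqrt (1 - 2 / 3 * a ^ 2) * Real.sqrt (1 - 2 / 3 * b ^ 2) *
      Real.cos (π / 3 - π / 6 * (a + b)) := by
  set s := Real.sqrt 3 with hs_def
  have hs : s ^ 2 = 3 := Real.sq_sqrt (by norm_num)
  have hs0 : 0 ≤ s := Real.sqrt_nonneg 3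
  have hs1 : 17 / 10 ≤ s := by nlinarith
  have hs2 : s ≤ 2 := by nlinarith
  have ha1 : a ≤ 1 := by linarith
  have hb1 : b ≤ 1 := by linarith
  have hXp : 0 ≤ 1 - 2 / 3 * a ^ 2 := by nlinarith
  have hYp : 0 ≤ 1 - 2 / 3 * b ^ 2 := by nlinarith
  set X := Real.sqrt (1 - 2 / 3 * a ^ 2) with hX_def
  set Y := Real.sqrt (1 - 2 / 3 * b ^ 2) with hY_def
  have hX2 : X ^ 2 = 1 - 2 / 3 * a ^ 2 := Real.sq_sqrt hXp
  have hY2 : Y ^ 2 = 1 - 2 / 3 * b ^ 2 := Real.sq_sqrt hYp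
  have hXY : 0 ≤ X * Y := mul_nonneg (Real.sqrt_nonneg _) (Real.sqrt_nonneg _)
  have hm := cos_pi_div_three_sub_ge_chord (x := a + b) (by linarith) hab
  have hm0 : 0 ≤ 1 / 2 + (s - 1) / 2 * (a + b) := by nlinarith
  have hL : 0 ≤ 1 / 2 + 2 / 3 * a * b := by nlinarith [mul_nonneg ha hb]
  have step : 1 / 2 + 2 / 3 * a * b ≤ X * Y * (1 / 2 + (s - 1) / 2 * (a + b)) := by
    rw [← pow_le_pow_iff_left₀ hL (mul_nonneg hXY hm0) two_ne_zero]
    have hA := windowPair_poly ha hb hab hs hs1 hs2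
    calc (1 / 2 + 2 / 3 * a * b) ^ 2 = (3 + 4 * a * b) ^ 2 / 36 := by ring
      _ ≤ (3 - 2 * a ^ 2) * (3 - 2 * b ^ 2) * (1 + (s - 1) * (a + b)) ^ 2 / 36 := by gcongr
      _ = (X * Y * (1 / 2 + (s - 1) / 2 * (a + b))) ^ 2 := by rw [mul_pow, mul_pow, hX2, hY2]; ring
  exact step.trans (mul_le_mul_of_nonneg_left hm hXY)

/-! ## 2. Azimuth gaps in a window of height `c` -/

/-- `⟪x, y⟫ = x₀y₀ + x₁y₁ + x₂y₂` in `ℝ³` (local copy). -/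
private theorem inner_three' (x y : EuclideanSpace ℝ (Fin 3)) :
    ⟪x, y⟫_ℝ = x 0 * y 0 + x 1 * y 1 + x 2 * y 2 := by
  simp [PiLp.inner_apply, Fin.sum_univ_three, mul_comm]

/-- The horizontal part of a unit vector of height `z` has norm `√(1 − z²)` (local copy). -/
private theorem norm_horiz' {u : EuclideanSpace ℝ (Fin 3)} (hu : ‖u‖ = 1) :
    ‖(⟨u 0, u 1⟩ : ℂ)‖ = Real.sqrt (1 - u 2 ^ 2) := by
  have h2 : ‖(⟨u 0, u 1⟩ : ℂ)‖ ^ 2 = 1 - u 2 ^ 2 := by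
    rw [Complex.sq_norm, Complex.normSq_mk]
    have h := real_inner_self_eq_norm_sq u
    rw [inner_three', hu, one_pow] at h
    nlinarith [h]
  rw [← h2, Real.sqrt_sq (norm_nonneg _)]

/-- **The pair lemma in a window of height `c` (azimuth form).**  Two unit vectors `u, v` of `ℝ³` with
`⟪u, v⟫ ≤ 1/2`, both with third coordinate in a window `[−d, c − d]`, `0 ≤ d ≤ c = √(2/3)`, whose azimuths about
`e₃` satisfy `θ_u ≤ θ_v`, have `θ_v − θ_u ≥ ω(u) + ω(v)` and `2π − (θ_v − θ_u) ≥ ω(u) + ω(v)` with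
`ω(w) = (π/6)(1 − |w₂|/c)`: same side of the equator — `hollowPair_cos_bound`; opposite sides —
`windowPair_cos_bound` (there `|u₂| + |v₂| ≤ c` because the window has height `c`). -/
theorem window_azimuthGap_ge {u v : EuclideanSpace ℝ (Fin 3)} {d : ℝ} (hd0 : 0 ≤ d)
    (hdc : d ≤ Real.sqrt (2 / 3)) (hu : ‖u‖ = 1) (hv : ‖v‖ = 1) (huv : ⟪u, v⟫_ℝ ≤ 1 / 2)
    (hu0 : -d ≤ u 2) (hu1 : u 2 ≤ Real.sqrt (2 / 3) - d) (hv0 : -d ≤ v 2) (hv1 : v 2 ≤ Real.sqrt (2 / 3) - d)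
    (hθ : Complex.arg ⟨u 0, u 1⟩ ≤ Complex.arg ⟨v 0, v 1⟩) :
    π / 6 * (1 - |u 2| / Real.sqrt (2 / 3)) + π / 6 * (1 - |v 2| / Real.sqrt (2 / 3)) ≤
        Complex.arg ⟨v 0, v 1⟩ - Complex.arg ⟨u 0, u 1⟩ ∧
      π / 6 * (1 - |u 2| / Real.sqrt (2 / 3)) + π / 6 * (1 - |v 2| / Real.sqrt (2 / 3)) ≤
        2 * π - (Complex.arg ⟨v 0, v 1⟩ - Complex.arg ⟨u 0, u 1⟩) := by
  set c : ℝ := Real.sqrt (2 / 3) with hc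
  have hc2 : c ^ 2 = 2 / 3 := Real.sq_sqrt (by norm_num)
  have hcpos : 0 < c := Real.sqrt_pos.2 (by norm_num)
  -- absolute heights as fractions of `c`
  set a : ℝ := |u 2| / c with ha_def
  set b : ℝ := |v 2| / c with hb_def
  have hua : |u 2| = c * a := by rw [ha_def]; field_simp
  have hvb : |v 2| = c * b := by rw [hb_def]; field_simp
  have ha0 : 0 ≤ a := div_nonneg (abs_nonneg _) hcpos.le
  have hb0 : 0 ≤ b := div_nonneg (abs_nonneg _) hcpos.le
  have hule : |u 2| ≤ c := by rw [abs_le]; constructor <;> linarith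
  have hvle : |v 2| ≤ c := by rw [abs_le]; constructor <;> linarith
  have ha1 : a ≤ 1 := by rw [ha_def, div_le_one hcpos]; exact hule
  have hb1 : b ≤ 1 := by rw [hb_def, div_le_one hcpos]; exact hvle
  -- horizontal parts
  set zu : ℂ := ⟨u 0, u 1⟩ with hzu
  set zv : ℂ := ⟨v 0, v 1⟩ with hzv
  have hnu : ‖zu‖ = Real.sqrt (1 - 2 / 3 * a ^ 2) := by
    rw [hzu, norm_horiz' hu, ← sq_abs (u 2), hua, mul_pow, hc2]
  have hnv : ‖zv‖ = Real.sqrt (1 - 2 / 3 * b ^ 2) := by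
    rw [hzv, norm_horiz' hv, ← sq_abs (v 2), hvb, mul_pow, hc2]
  have hXpos : 0 < 1 - 2 / 3 * a ^ 2 := by nlinarith
  have hYpos : 0 < 1 - 2 / 3 * b ^ 2 := by nlinarith
  have hnu0 : 0 < ‖zu‖ := by rw [hnu]; exact Real.sqrt_pos.2 hXpos
  have hnv0 : 0 < ‖zv‖ := by rw [hnv]; exact Real.sqrt_pos.2 hYpos
  have hzu0 : zu ≠ 0 := norm_pos_iff.1 hnu0
  have hzv0 : zv ≠ 0 := norm_pos_iff.1 hnv0
  have hin : ⟪u, v⟫_ℝ = ‖zu‖ * ‖zv‖ * Real.cos (Complex.arg zu - Complex.arg zv) + u 2 * v 2 := by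
    rw [inner_three', ← re_mul_add_im_mul zu zv hzu0 hzv0]
  set B : ℝ := π / 3 - π / 6 * (a + b) with hB
  have hB0 : 0 ≤ B := by rw [hB]; nlinarith [pi_pos]
  have hBπ : B ≤ π := by rw [hB]; nlinarith [pi_pos]
  -- the middle inequality `1/2 − u₂ v₂ ≤ ‖zu‖ ‖zv‖ cos B`, by sign cases
  have hmid : 1 / 2 - u 2 * v 2 ≤ ‖zu‖ * ‖zv‖ * Real.cos B := by
    rw [hnu, hnv, hB]
    by_cases hsgn : 0 ≤ u 2 * v 2
    · -- same side: `u₂ v₂ = |u₂| |v₂| = (2/3) a b`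
      have h1 : u 2 * v 2 = 2 / 3 * a * b := by
        rw [← abs_of_nonneg hsgn, abs_mul, hua, hvb]
        have e : c * a * (c * b) = c ^ 2 * (a * b) := by ring
        rw [e, hc2]; ring
      rw [h1]
      exact hollowPair_cos_bound ha0 ha1 hb0 hb1
    · -- opposite sides: `u₂ v₂ = −|u₂| |v₂|` and `|u₂| + |v₂| ≤ c`
      push Not at hsgn
      have h1 : u 2 * v 2 = -(2 / 3 * a * b) := by
        rw [← neg_neg (u 2 * v 2), ← abs_of_neg hsgn, abs_mul, hua, hvb]
        have e : c * a * (c * b) = c ^ 2 * (a * b) := by ring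
        rw [e, hc2]; ring
      have hsum : |u 2| + |v 2| ≤ c := by
        rcases lt_or_ge (u 2) 0 with hu' | hu'
        · have hv' : 0 < v 2 := by
            by_contra h; push Not at h
            exact absurd (mul_nonneg_of_nonpos_of_nonpos hu'.le h) (not_le.2 hsgn)
          rw [abs_of_neg hu', abs_of_pos hv']; linarith
        · have hv' : v 2 < 0 := by
            by_contra h; push Not at h
            exact absurd (mul_nonneg hu' h) (not_le.2 hsgn)
          rw [abs_of_nonneg hu', abs_of_neg hv']; linarith
      have hab : a + b ≤ 1 := by
        have : c * (a + b) ≤ c * 1 := by rw [mul_add, ← hua, ← hvb, mul_one]; exact hsum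
        exact le_of_mul_le_mul_left this hcpos
      rw [h1, sub_neg_eq_add]
      exact windowPair_cos_bound ha0 hb0 hab
  have h1 : ‖zu‖ * ‖zv‖ * Real.cos (Complex.arg zu - Complex.arg zv) ≤ ‖zu‖ * ‖zv‖ * Real.cos B := by
    linarith [hin, huv, hmid]
  have hcosle : Real.cos (Complex.arg zv - Complex.arg zu) ≤ Real.cos B := by
    rw [← Real.cos_neg, neg_sub]
    exact le_of_mul_le_mul_left h1 (mul_pos hnu0 hnv0)
  have hx0 : 0 ≤ Complex.arg zv - Complex.arg zu := by linarith
  have hx1 : Complex.arg zv - Complex.arg zu ≤ 2 * π := by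
    linarith [Complex.arg_le_pi zv, Complex.neg_pi_lt_arg zu]
  have harc := Literature.Geometry.DiscreteGeometry.arccos_le_and_le_of_cos_le hx0 hx1 hcosle
  rw [Real.arccos_cos hB0 hBπ] at harc
  have hω : π / 6 * (1 - |u 2| / c) + π / 6 * (1 - |v 2| / c) = B := by
    rw [hB, ← ha_def, ← hb_def]; ring
  rw [hω]
  exact harc

/-! ## 3. The sliding-window weighted kissing bound -/

/-- **Sliding-window weighted one-sided kissing bound.**  For every finite `60°`-code `F` of unit vectors of
`ℝ³` and every `d ∈ [0, √(2/3)]`, the vectors with third coordinate in the window `[−d, √(2/3) − d]` have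
total weight `Σ (1 − |u₂|/√(2/3)) ≤ 6`.  Tight at `d = 0` (hexagon + three tops: the hollow-ball code) and at
`d = √(2/3)` (Kertész's nine-point code: the top ball of a close-packed bilayer). -/
theorem weightedWindowKissing_le_six (F : Finset (EuclideanSpace ℝ (Fin 3))) (h1 : ∀ u ∈ F, ‖u‖ = 1)
    (h2 : ∀ u ∈ F, ∀ v ∈ F, u ≠ v → ⟪u, v⟫_ℝ ≤ 1 / 2) {d : ℝ} (hd0 : 0 ≤ d)
    (hdc : d ≤ Real.sqrt (2 / 3)) :
    ∑ u ∈ F.filter (fun u => -d ≤ u 2 ∧ u 2 ≤ Real.sqrt (2 / 3) - d),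
      (1 - |u 2| / Real.sqrt (2 / 3)) ≤ 6 := by
  classical
  set c : ℝ := Real.sqrt (2 / 3) with hc
  have hcpos : 0 < c := Real.sqrt_pos.2 (by norm_num)
  set S := F.filter (fun u => -d ≤ u 2 ∧ u 2 ≤ c - d) with hS
  have hSmem : ∀ u, u ∈ S ↔ u ∈ F ∧ -d ≤ u 2 ∧ u 2 ≤ c - d := fun u => by rw [hS, mem_filter]
  set t : EuclideanSpace ℝ (Fin 3) → ℝ := fun u => Complex.arg ⟨u 0, u 1⟩ with ht
  set f : EuclideanSpace ℝ (Fin 3) → ℝ := fun u => π / 6 * (1 - |u 2| / c) with hf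
  have hfle : ∀ u ∈ S, f u ≤ π := by
    intro u _
    have : 0 ≤ |u 2| / c := div_nonneg (abs_nonneg _) hcpos.le
    simp only [hf]
    nlinarith [pi_pos]
  have hgap : ∀ a ∈ S, ∀ b ∈ S, a ≠ b → t a ≤ t b →
      f a + f b ≤ t b - t a ∧ f a + f b ≤ 2 * π - (t b - t a) := by
    intro a ha b hb hab htab
    have ha' := (hSmem a).1 ha
    have hb' := (hSmem b).1 hb
    exact window_azimuthGap_ge hd0 hdc (h1 a ha'.1) (h1 b hb'.1) (h2 a ha'.1 b hb'.1 hab) ha'.2.1 ha'.2.2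
      hb'.2.1 hb'.2.2 htab
  have hsum := azimuth_weighted_budget t f S hfle hgap
  have hrew : ∑ x ∈ S, f x = π / 6 * ∑ x ∈ S, (1 - |x 2| / c) := by
    rw [hf, mul_sum]
  rw [hrew] at hsum
  have hπ := pi_pos
  by_contra hlt
  push Not at hlt
  nlinarith [hsum, hlt]

end Summit.Ventures.Crystal3D.Theorems

end
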